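import Mathlib
import HarnessLib
import Literature.NumberTheory.Transcendental.KZKernelConjectureForms
import Summits.KontsevichZagierPeriods.KontsevichZagierPeriods.Theses.LinRedNormalForm

/-!
# Route LinRedNormalForm, item `ResidualBeyondGenusZero` (stmt-KontsevichZagierPeriods-3917): strength of the declared residual

The support item `ResidualBeyondGenusZero` of route LinRedNormalForm ("every vanishing formal
combination of integral representations is congruent modulo `KZ.relations` to a `ℤ`-combination
of genus-zero representations") is the route's DECLARED RESIDUAL: it is filed so that the route's
assembly is an honest implication ending in the summit, not as a claim to be proved inside the
route. This file records, sorry-free, exactly how strong it is: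

* `residualBeyondGenusZero_of_kzKernelConjecture` — the kernel form of Conjecture 1
  (`Literature.NumberTheory.Transcendental.KZKernelConjecture`, `ker eval = relations`, OPEN)
  implies it (take `c₀ = 0`);
* `residualBeyondGenusZero_of_kontsevichZagierPeriods` — hence so does the summit statement
  `KontsevichZagierPeriods` itself (kernel form ⇔ KZ-literal form,
  `Literature.NumberTheory.Transcendental.kzKernelConjecture_iff_isRational`);
* `kzKernelConjecture_iff_residual_and_genusZeroKernel` — unconditionally, the kernel conjecture
  SPLITS as (residual) ∧ (genus-zero kernel: every vanishing `ℤ`-combination of genus-zero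
  representations is a relation; the genus-zero representations are written out verbatim as in the
  route decls, no name is introduced); the second conjunct is what the sector cruxes
  `DihedralNormalForm` + `MzvKernelInKZ` supply (`genusZeroKernel_of_sector`);
* `kontsevichZagierPeriods_iff_residualBeyondGenusZero` — so, granted the two sector cruxes, the
  residual is EQUIVALENT to the summit (self-contained; the route's deciding theorem `closes` was
  re-typed on 2026-08-16 and is no longer used here).

Consequently neither `ResidualBeyondGenusZero` nor its negation is accessible short of settling the
Kontsevich–Zagier period conjecture over the fixed calculus (a proof of `¬ ResidualBeyondGenusZero`
would refute the summit by `residualBeyondGenusZero_of_kontsevichZagierPeriods`).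

References: M. Kontsevich, D. Zagier, *Periods* (2001), §1.2, Conjecture 1; A. Huber,
S. Müller-Stach, *Periods and Nori Motives* (2017), Conj. 13.2.1 (kernel form).
-/

noncomputable section

namespace Summit.KontsevichZagierPeriods.ResidualBeyondGenusZero

open Literature.NumberTheory.Transcendental
open Summit.KontsevichZagierPeriods.KontsevichZagierPeriods.Theses.LinRedNormalForm

/-- **Kernel conjecture ⇒ residual.** If `ker eval = relations`
(`Literature.NumberTheory.Transcendental.KZKernelConjecture`, the kernel form of Conjecture 1 of
Kontsevich–Zagier 2001, §1.2 — an OPEN conjecture, taken here as a hypothesis), then every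
vanishing combination is itself a relation, so `c₀ = 0` witnesses `ResidualBeyondGenusZero`.
[folklore] -/
theorem residualBeyondGenusZero_of_kzKernelConjecture (hK : KZKernelConjecture) :
    ResidualBeyondGenusZero := by
  intro c hc
  exact ⟨0, zero_mem _, by simpa using hK c hc⟩

/-- **Summit ⇒ residual.** The summit statement `KontsevichZagierPeriods` (Conjecture 1 with
KZ-literal rational endpoints) is equivalent to the kernel form
(`Literature.NumberTheory.Transcendental.kzKernelConjecture_iff_isRational`, proved in tree from
`KZ.exists_integralRep_sub_holds` and `KZ.exists_isRational_equivalent_holds`), hence implies the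
declared residual. In particular a refutation of `ResidualBeyondGenusZero` would refute the summit.
[folklore] -/
theorem residualBeyondGenusZero_of_kontsevichZagierPeriods (h : KontsevichZagierPeriods) :
    ResidualBeyondGenusZero :=
  residualBeyondGenusZero_of_kzKernelConjecture (kzKernelConjecture_iff_isRational.mpr h)

/-- **The kernel conjecture splits exactly into the residual and the genus-zero kernel.**
`ker eval = relations` holds if and only if (i) every vanishing combination is congruent modulo
relations to a combination of genus-zero representations (`ResidualBeyondGenusZero`) and (ii) every
VANISHING `ℤ`-combination of genus-zero representations is a relation. (⇒): (i) with `c₀ = 0`,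
(ii) is a special case. (⇐): given `eval c = 0`, (i) gives `c₀` with `c - c₀ ∈ relations`;
soundness of the calculus (`KZ.relations_le_ker_eval_holds`) gives `eval c₀ = eval c = 0`, so
`c₀ ∈ relations` by (ii), and `c = (c - c₀) + c₀`. [folklore] -/
theorem kzKernelConjecture_iff_residual_and_genusZeroKernel :
    KZKernelConjecture ↔
      ResidualBeyondGenusZero ∧
        ∀ c₀ ∈ AddSubgroup.closure
        {x : KZ.FormalRep | ∃ (k : ℕ) (r : KZ.IntegralRep k)
          (p : MvPolynomial (Fin k) ℚ) (a : Fin k → Fin k → ℕ) (b c : Fin k → ℕ),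
          r.domain = {t | (∀ i, 0 < t i) ∧ (∀ i, t i < 1) ∧ StrictAnti t} ∧
          Set.EqOn r.integrand (fun t => MvPolynomial.aeval t p / ((∏ i, t i ^ b i) *
            (∏ i, (1 - t i) ^ c i) * ∏ i, ∏ j, if i < j then (t i - t j) ^ a i j else 1))
            r.domain ∧ x = KZ.of r}, KZ.eval c₀ = 0 → c₀ ∈ KZ.relations := by
  constructor
  · intro hK
    exact ⟨residualBeyondGenusZero_of_kzKernelConjecture hK, fun c₀ _ hc₀ => hK c₀ hc₀⟩
  · rintro ⟨hRES, hGZ⟩ c hc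
    obtain ⟨c₀, hc₀, hcc₀⟩ := hRES c hc
    have hsound : KZ.eval (c - c₀) = 0 :=
      (AddMonoidHom.mem_ker).1 (KZ.relations_le_ker_eval_holds hcc₀)
    rw [map_sub, hc, zero_sub, neg_eq_zero] at hsound
    have key := add_mem hcc₀ (hGZ c₀ hc₀ hsound)
    rwa [sub_add_cancel] at key

/-- **The sector cruxes give the genus-zero kernel.** Granted the genus-zero normal form
`DihedralNormalForm` (every genus-zero representation is congruent to a `ℤ`-combination of MZV
word representations) and the kernel on normal forms `MzvKernelInKZ`, every vanishing
`ℤ`-combination `c₀` of genus-zero representations is a relation: extend the normal form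
additively over `AddSubgroup.closure` to get `m` in the closure of the MZV word representations
with `c₀ - m ∈ relations`; soundness gives `eval m = 0`, so `m ∈ relations`, and
`c₀ = (c₀ - m) + m`. (Both hypotheses are open cruxes of route LinRedNormalForm, taken as
hypotheses.) [folklore] -/
theorem genusZeroKernel_of_sector (hNF : DihedralNormalForm) (hKER : MzvKernelInKZ) :
    ∀ c₀ ∈ AddSubgroup.closure
        {x : KZ.FormalRep | ∃ (k : ℕ) (r : KZ.IntegralRep k)
          (p : MvPolynomial (Fin k) ℚ) (a : Fin k → Fin k → ℕ) (b c : Fin k → ℕ),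
          r.domain = {t | (∀ i, 0 < t i) ∧ (∀ i, t i < 1) ∧ StrictAnti t} ∧
          Set.EqOn r.integrand (fun t => MvPolynomial.aeval t p / ((∏ i, t i ^ b i) *
            (∏ i, (1 - t i) ^ c i) * ∏ i, ∏ j, if i < j then (t i - t j) ^ a i j else 1))
            r.domain ∧ x = KZ.of r}, KZ.eval c₀ = 0 → c₀ ∈ KZ.relations := by
  intro c₀ hc₀ hev
  -- additive extension of the generator-wise normal form to the generated subgroup
  have hext : ∀ c : KZ.FormalRep, c ∈ AddSubgroup.closure
        {x : KZ.FormalRep | ∃ (k : ℕ) (r : KZ.IntegralRep k)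
          (p : MvPolynomial (Fin k) ℚ) (a : Fin k → Fin k → ℕ) (b c : Fin k → ℕ),
          r.domain = {t | (∀ i, 0 < t i) ∧ (∀ i, t i < 1) ∧ StrictAnti t} ∧
          Set.EqOn r.integrand (fun t => MvPolynomial.aeval t p / ((∏ i, t i ^ b i) *
            (∏ i, (1 - t i) ^ c i) * ∏ i, ∏ j, if i < j then (t i - t j) ^ a i j else 1))
            r.domain ∧ x = KZ.of r} →
      ∃ m ∈ AddSubgroup.closure {x : KZ.FormalRep | ∃ (w : ℕ) (ε : Fin w → Bool) (q : ℚ)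
          (s : KZ.IntegralRep w),
          s.domain = {t | (∀ i, 0 < t i) ∧ (∀ i, t i < 1) ∧ StrictAnti t} ∧
          Set.EqOn s.integrand (fun t => (q : ℝ) * ∏ i, if ε i then 1 / (1 - t i) else 1 / t i)
            s.domain ∧ x = KZ.of s},
        c - m ∈ KZ.relations := by
    intro c hc
    induction hc using AddSubgroup.closure_induction with
    | mem x hx =>
      obtain ⟨k, s, p, a, b, e, hdom, hint, rfl⟩ := hx
      exact hNF k s p a b e hdom hint
    | zero => exact ⟨0, zero_mem _, by simp⟩
    | add x y _ _ ihx ihy =>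
      obtain ⟨m₁, hm₁, h₁⟩ := ihx
      obtain ⟨m₂, hm₂, h₂⟩ := ihy
      refine ⟨m₁ + m₂, add_mem hm₁ hm₂, ?_⟩
      have key := add_mem h₁ h₂
      rwa [show x - m₁ + (y - m₂) = x + y - (m₁ + m₂) by abel] at key
    | neg x _ ih =>
      obtain ⟨m, hm, h⟩ := ih
      refine ⟨-m, neg_mem hm, ?_⟩
      have key := neg_mem h
      rwa [show -(x - m) = -x - -m by abel] at key
  obtain ⟨m, hm, hcm⟩ := hext c₀ hc₀
  have hsound : KZ.eval (c₀ - m) = 0 :=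
    (AddMonoidHom.mem_ker).1 (KZ.relations_le_ker_eval_holds hcm)
  rw [map_sub, hev, zero_sub, neg_eq_zero] at hsound
  have key := add_mem hcm (hKER m hm hsound)
  rwa [sub_add_cancel] at key

/-- **Granted the sector cruxes, the residual is the kernel conjecture.** Under
`DihedralNormalForm` and `MzvKernelInKZ` (open cruxes of route LinRedNormalForm, taken as
hypotheses), `ResidualBeyondGenusZero ↔ KZKernelConjecture`
(`kzKernelConjecture_iff_residual_and_genusZeroKernel` + `genusZeroKernel_of_sector`). [folklore] -/
theorem residualBeyondGenusZero_iff_kzKernelConjecture (hNF : DihedralNormalForm)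
    (hKER : MzvKernelInKZ) : ResidualBeyondGenusZero ↔ KZKernelConjecture :=
  ⟨fun hRES => kzKernelConjecture_iff_residual_and_genusZeroKernel.mpr
      ⟨hRES, genusZeroKernel_of_sector hNF hKER⟩,
    residualBeyondGenusZero_of_kzKernelConjecture⟩

/-- **Granted the sector cruxes, the residual is the summit.** Under `DihedralNormalForm` and
`MzvKernelInKZ` (open cruxes of route LinRedNormalForm, taken as hypotheses),
`KontsevichZagierPeriods ↔ ResidualBeyondGenusZero`: (⇒) is
`residualBeyondGenusZero_of_kontsevichZagierPeriods` (unconditional), (⇐) is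
`residualBeyondGenusZero_iff_kzKernelConjecture` followed by the kernel-form/KZ-literal equivalence
`kzKernelConjecture_iff_isRational` (formerly the route's deciding theorem `closes`, whose hypotheses
changed at the route repair of 2026-08-16T07:36Z — `HoffmanSpanInKZ`, `HoffmanIndependence` instead of
`MzvKernelInKZ`; proof made self-contained at the fullbuild repair of 2026-08-16, statement unchanged).
This is the precise sense in which the item is a summit-strength declared residual. [folklore] -/
theorem kontsevichZagierPeriods_iff_residualBeyondGenusZero (hNF : DihedralNormalForm)
    (hKER : MzvKernelInKZ) : KontsevichZagierPeriods ↔ ResidualBeyondGenusZero :=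
  ⟨residualBeyondGenusZero_of_kontsevichZagierPeriods, fun hRES =>
    KontsevichZagierPeriods_iff.mpr (kzKernelConjecture_iff_isRational.mp
      ((residualBeyondGenusZero_iff_kzKernelConjecture hNF hKER).mp hRES))⟩

end Summit.KontsevichZagierPeriods.ResidualBeyondGenusZero
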